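import Summits.CriticalPhenomena.PercolationContinuityZ3.Theorems.PercNearOneGluingNoHeavyLowerTailThreePartitionCombBridge
import Summits.CriticalPhenomena.PercolationContinuityZ3.Theorems.PercNearOneGluingNoHeavyLowerTailThreePartitionTwistedUniv

/-!
# `NoHeavyLowerTail` (crux stmt-CriticalPhenomena-4575): CONJECTURE V — the three-partition kernel of `E₃` is up-set-nonnegative on the
# FACE POSET OF THE CUBE — and the bridge `VOrderPositivity → ThreePartitionPositivityTwisted → MasterFamilyNonneg 3`

Support file (lineage `prim-bnk-2`, generation 23; `--supports stmt-CriticalPhenomena-4575`; memo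
`run/shared/lean/prim/prim-l12/FROM-prim-bnk-2-g23-CONJ-V.md`).  No `sorry`, standard axioms; the only unproved statement is the
`@[conjecture]`-tagged `VOrderPositivity`, used as an explicit hypothesis.

The twisted three-partition functional of `…ThreePartitionADTwisted` is a CYLINDER SUM of one kernel on ordered 3-partitions
`(S₁,S₂,S₃)` (copies `a = S₁ ∆ τ`, `b = S₂ ∆ τ`, `c = S₃ ∆ τ`):
  `threePartNT τ 𝒰 𝒱 𝒲 = Σ_{a ∈ 𝒰} K_{𝒱,𝒲}(a,b,c)`,
  `K_{𝒱,𝒲}(a,b,c) = 2[a∈𝒱][a∈𝒲] + [c∈𝒱][b∈𝒲] − [a∈𝒲][c∈𝒱] − [a∈𝒱][c∈𝒲] − [c∈𝒱][c∈𝒲]`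
(`vSumT_fst_eq_threePartNT`; the sum is written directly as a signed combination of five `triT` counts, `vSumT`).
**Conjecture V** (`VOrderPositivity`, this work, OPEN): for all up-sets `𝒱, 𝒲`, every twist `τ` and every family `𝒳` of pairs that is an
up-set for the COPY ORDER (`a ⊆ a'` and `b ⊆ b'`, the product order on `Set ι × Set ι`) the kernel sum over the 3-partitions whose first two parts lie in `𝒳` is `≥ 0`.
In the untwisted picture the copy order on 3-partitions is the product poset `{0<+,0<−}^ι` (part 3 = free coordinates), i.e. the face poset
of the cube `[−1,1]^ι` reversed, and the up-sets are its SUBCOMPLEXES; cylinders `{a ∈ 𝒰}` (`isUpperSet_fst_mem`), the chain-order up-sets of the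
`GRID` conjecture and the rectangles `{a∈𝒰}×{b∈𝒰'}` are all copy-order up-sets, so Conjecture V contains all three.  Census (memo §1/§8,
engines `code/g23/vtest.c`): `m ≤ 4` exhaustive over all `(𝒱,𝒲,τ)` (451 584 instances), `m = 5` exhaustive for `τ = ∅` by orbit representatives
(1 592 010), `m = 5, 6` sampled (7.7·10⁵): no failure; the case `𝒱 = 𝒲` is proved on paper (two Kleitman–Hall matchings, memo §3).
Consequences proved here: `threePartitionPositivityTwisted_of_vOrderPositivity` and `masterFamilyNonneg_three_of_vOrderPositivity`
(Sahi's `C₃` on every product measure = Kahn's Conjecture 5, `masterFamilyNonneg_three_iff_kahnConjecture`). [this work]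
-/

noncomputable section

open Finset
open scoped symmDiff Classical

namespace Summit.CriticalPhenomena.PercolationContinuityZ3.Theorems.ThreePartition

variable {ι : Type*} [Fintype ι]

/-! ## Slot symmetry `2 ↔ 3` of the partition count -/

/-- Swapping parts 2 and 3 does not change a 3-partition count. [this work] -/
theorem tri_swap23 (p : Set ι → Set ι → Set ι → Prop) : tri p = tri (fun S₁ S₂ S₃ => p S₁ S₃ S₂) := by
  rw [tri_swap12, tri_swap13, tri_swap12]

/-- Twisted version of `tri_swap13`. [this work] -/
theorem triT_swap13 (τ : Set ι) (p : Set ι → Set ι → Set ι → Prop) :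
    triT τ p = triT τ (fun a b c => p c b a) := by
  unfold triT; rw [tri_swap13]

/-- Twisted version of `tri_swap23`. [this work] -/
theorem triT_swap23 (τ : Set ι) (p : Set ι → Set ι → Set ι → Prop) :
    triT τ p = triT τ (fun a b c => p a c b) := by
  unfold triT; rw [tri_swap23]

/-- `triT` only depends on the predicate's values. [this work] -/
theorem triT_congr {τ : Set ι} {p q : Set ι → Set ι → Set ι → Prop} (h : ∀ a b c, p a b c ↔ q a b c) :
    triT τ p = triT τ q := by
  unfold triT
  exact tri_congr fun S₁ S₂ S₃ => h _ _ _

/-! ## The kernel sum over a family of pairs, the copy order, Conjecture V -/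

/-- **The kernel sum** of `K_{𝒱,𝒲}(a,b,c) = 2[a∈𝒱𝒲] + [c∈𝒱][b∈𝒲] − [a∈𝒲][c∈𝒱] − [a∈𝒱][c∈𝒲] − [c∈𝒱𝒲]` over the ordered
3-partitions `(S₁,S₂,S₃)` (copies `a = S₁∆τ, b = S₂∆τ, c = S₃∆τ`) whose pair of first copies `(a,b)` lies in `𝒳`, written as the signed
combination of the five twisted counts. [this work] -/
def vSumT (τ : Set ι) (𝒱 𝒲 : Set (Set ι)) (𝒳 : Set (Set ι × Set ι)) : ℤ :=
  2 * (triT τ (fun a b _ => (a, b) ∈ 𝒳 ∧ a ∈ 𝒱 ∧ a ∈ 𝒲) : ℤ)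
    + triT τ (fun a b c => (a, b) ∈ 𝒳 ∧ c ∈ 𝒱 ∧ b ∈ 𝒲)
    - (triT τ (fun a b c => (a, b) ∈ 𝒳 ∧ a ∈ 𝒲 ∧ c ∈ 𝒱) + triT τ (fun a b c => (a, b) ∈ 𝒳 ∧ a ∈ 𝒱 ∧ c ∈ 𝒲)
        + triT τ (fun a b c => (a, b) ∈ 𝒳 ∧ c ∈ 𝒱 ∧ c ∈ 𝒲) : ℕ)

omit [Fintype ι] in
/-- Cylinders `{(a,b) : a ∈ 𝒰}` over an up-set `𝒰` are up-sets of the COPY ORDER on pairs (the product order `a ⊆ a'`, `b ⊆ b'` of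
`Set ι × Set ι`; on 3-partitions it is generated by moving single elements of copy `c` into `a` or into `b` — untwisted: from the free
part into part 1 or part 2 — and its up-sets are the subcomplexes of the cube). [this work] -/
theorem isUpperSet_fst_mem {𝒰 : Set (Set ι)} (h𝒰 : IsUpperSet 𝒰) : IsUpperSet {q : Set ι × Set ι | q.1 ∈ 𝒰} :=
  fun _ _ hle hq => h𝒰 hle.1 hq

/-- **CONJECTURE V** (this work; OPEN): for every finite ground set, every twist `τ`, all up-sets `𝒱, 𝒲` and every up-set `𝒳` of the
copy order (product order on `Set ι × Set ι`), the kernel sum `vSumT τ 𝒱 𝒲 𝒳` is `≥ 0` — the three-partition kernel of `E₃` is up-set-nonnegative on the face poset of the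
cube.  Census: `m ≤ 4` exhaustive over `(𝒱,𝒲,τ)` (451 584), `m = 5` exhaustive for `τ = ∅` by orbit representatives (1 592 010), `m = 5,6` sampled,
`0` failures (memo `FROM-prim-bnk-2-g23-CONJ-V.md`, `code/g23/vtest.c`); proved on paper for `𝒱 = 𝒲`.  It implies
`ThreePartitionPositivityTwisted` (`threePartitionPositivityTwisted_of_vOrderPositivity`), hence Sahi's `C₃` on product measures.
An obligation of our theories, never a fact: use as `(h : VOrderPositivity)`. [status: open] -/
@[conjecture] def VOrderPositivity : Prop :=
  ∀ (ι : Type) [Fintype ι] (τ : Set ι) (𝒱 𝒲 : Set (Set ι)) (𝒳 : Set (Set ι × Set ι)),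
    IsUpperSet 𝒱 → IsUpperSet 𝒲 → IsUpperSet 𝒳 → 0 ≤ vSumT τ 𝒱 𝒲 𝒳

/-! ## Cylinder sums of the kernel are the twisted three-partition functional -/

/-- **`Σ_{a ∈ 𝒰} K_{𝒱,𝒲} = threePartNT τ 𝒰 𝒱 𝒲`**: on the cylinder `{(a,b) : a ∈ 𝒰}` the kernel sum is the twisted three-partition
functional (the five counts agree after the slot swaps `1 ↔ 3` and `2 ↔ 3`). [this work] -/
theorem vSumT_fst_eq_threePartNT (τ : Set ι) (𝒰 𝒱 𝒲 : Set (Set ι)) :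
    vSumT τ 𝒱 𝒲 {q : Set ι × Set ι | q.1 ∈ 𝒰} = threePartNT τ 𝒰 𝒱 𝒲 := by
  unfold vSumT threePartNT
  have h1 : triT τ (fun a b _ => (a, b) ∈ {q : Set ι × Set ι | q.1 ∈ 𝒰} ∧ a ∈ 𝒱 ∧ a ∈ 𝒲) = topT τ (𝒰 ∩ 𝒱 ∩ 𝒲) := by
    unfold topT
    rw [triT_swap13 τ (fun _ _ x₃ => x₃ ∈ 𝒰 ∩ 𝒱 ∩ 𝒲)]
    exact triT_congr fun a b c => by simp only [Set.mem_setOf_eq, Set.mem_inter_iff, and_assoc]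
  have h2 : triT τ (fun a b c => (a, b) ∈ {q : Set ι × Set ι | q.1 ∈ 𝒰} ∧ c ∈ 𝒱 ∧ b ∈ 𝒲) = teeT τ 𝒰 𝒱 𝒲 := by
    unfold teeT
    rw [triT_swap23 τ (fun x₁ x₂ x₃ => x₁ ∈ 𝒰 ∧ x₂ ∈ 𝒱 ∧ x₃ ∈ 𝒲)]
    exact triT_congr fun a b c => by simp only [Set.mem_setOf_eq]
  have h3 : triT τ (fun a b c => (a, b) ∈ {q : Set ι × Set ι | q.1 ∈ 𝒰} ∧ a ∈ 𝒲 ∧ c ∈ 𝒱) = deeT τ 𝒱 (𝒰 ∩ 𝒲) := by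
    unfold deeT
    rw [triT_swap13 τ (fun x₁ _ x₃ => x₁ ∈ 𝒱 ∧ x₃ ∈ 𝒰 ∩ 𝒲)]
    exact triT_congr fun a b c => by simp only [Set.mem_setOf_eq, Set.mem_inter_iff]; tauto
  have h4 : triT τ (fun a b c => (a, b) ∈ {q : Set ι × Set ι | q.1 ∈ 𝒰} ∧ a ∈ 𝒱 ∧ c ∈ 𝒲) = deeT τ 𝒲 (𝒰 ∩ 𝒱) := by
    unfold deeT
    rw [triT_swap13 τ (fun x₁ _ x₃ => x₁ ∈ 𝒲 ∧ x₃ ∈ 𝒰 ∩ 𝒱)]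
    exact triT_congr fun a b c => by simp only [Set.mem_setOf_eq, Set.mem_inter_iff]; tauto
  have h5 : triT τ (fun a b c => (a, b) ∈ {q : Set ι × Set ι | q.1 ∈ 𝒰} ∧ c ∈ 𝒱 ∧ c ∈ 𝒲) = deeT τ 𝒰 (𝒱 ∩ 𝒲) := by
    unfold deeT
    exact triT_congr fun a b c => by simp only [Set.mem_setOf_eq, Set.mem_inter_iff]
  rw [h1, h2, h3, h4, h5]
  push_cast
  ring

/-! ## The bridge -/

/-- **Conjecture V ⟹ (★★)**: up-set-nonnegativity of the kernel on the face poset of the cube gives twisted three-partition positivity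
(test the cylinder `{a ∈ 𝒰}`). [this work] -/
theorem threePartitionPositivityTwisted_of_vOrderPositivity (h : VOrderPositivity) : ThreePartitionPositivityTwisted := by
  intro ι _ τ 𝒰 𝒱 𝒲 h𝒰 h𝒱 h𝒲
  rw [← vSumT_fst_eq_threePartNT]
  exact h ι τ 𝒱 𝒲 _ h𝒱 h𝒲 (isUpperSet_fst_mem h𝒰)

/-- **Conjecture V ⟹ Sahi's `C₃` on every product measure** (`MasterFamilyNonneg 3`, = Kahn's Conjecture 5 by
`masterFamilyNonneg_three_iff_kahnConjecture`). [this work] -/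
theorem masterFamilyNonneg_three_of_vOrderPositivity (h : VOrderPositivity) : MasterFamilyNonneg 3 :=
  masterFamilyNonneg_three_of_threePartitionPositivityTwisted (threePartitionPositivityTwisted_of_vOrderPositivity h)

end Summit.CriticalPhenomena.PercolationContinuityZ3.Theorems.ThreePartition
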